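import Summits.CriticalPhenomena.PercolationContinuityZ3.Theorems.Transplant.SkelPhiConcReachHabRes
import Summits.CriticalPhenomena.PercolationContinuityZ3.Theorems.Transplant.SkelPhiConcReachExcess
import Summits.CriticalPhenomena.PercolationContinuityZ3.Theorems.Transplant.SkelPhiConcReachDeep
import Summits.CriticalPhenomena.PercolationContinuityZ3.Theorems.Transplant.SkelPhiConcRealised
import HarnessLib

/-!
# Residue (C) of route D″ v2, STRUCTURE-FREE generic layer, RUN FORM (DPRIME-SCOPE §2 (C); rulings R1–R3 2026-08-21T05:09:29Z):
# `Skel.ReachOblRH` for the two-unit concentric scheme of record `⟨Skelφ.cellGeomSG G φ P t (Skelφ.concRadii2S P gap gap' E₀ L'), q, δc⟩`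
# from per-probe PLANAR SCHEDULES `SchOf y du : ChainPlanar.Schedule` (three rooms, length `≤ nmaxC`, radius `R'`), the schedule rooms of the
# radii (`20·rmax ≤ gap`, `L' ≤ gap`, `44·rmax + 3 ≤ E₀`), a uniform excess radius `Rex` synchronised with the radii, the count, and the per-step kit
# clauses at run histories for the window-chain records whose rim parts COVER the far vertices (the dischargeable premise) — φ-level twin of
# `Skel.reachOblRH_concSG'` (SkelConcReachRun, p5-g4/p3-g5), schedule-generic (cf. finding F-DP4-1: the length bound is the hypothesis `hn`)

builds on p205010 (kernel theorem, internal audit signed; external expert review pending) — nothing in this file uses p205010.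
Lane `prim-bschramm`, seat `prim-bschramm-p5` (gen 6; (C) column of the D″ order of battle), helper file (`--supports stmt-CriticalPhenomena-4575 --as helper`).
Composition of landed φ-level pieces: `Skelφ.reach_radii_concSG` (p248985), `Skelφ.deep_of_run` (p248998), `Skelφ.real_rim_le_concSG` (p249187),
`Skelφ.reachOblAtH_of_schedule` (SkelPhiConcReachHabRes), and the Φ-free `l1_tgt_le_nQ`, `KSchA.stN_eq₂`, `tgt_tgt_rev`.
* §0 `BoxProdZ2.add_mul_le_Erad` (linear drift below the radii, any slope `m ≤ gap`);
* §1 **`Skelφ.reachOblRH_of_schedules`** (`hlip hstep`; statement shape of `Skel.reachOblRH_concSG'` with `C.r ↦ P.rmax`, `HabChainData ↦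
  WinChainData + SchOf`, the twelve field equations ↦ six, the rim-covering clause over `(planarWindowIn hlip habΩ).stepD (SchOf y du) k`).
[cite: KozmaNitzan2024, §4 Lemma 12 (pp. 23–25), p. 30 (Step IV), p. 31]
-/

noncomputable section

open MeasureTheory

namespace Summit.CriticalPhenomena.PercolationContinuityZ3.Theorems

namespace Transplant

/-! ## §0 Linear drift below the radii -/

namespace BoxProdZ2

/-- The recursion dominates a linear drift: `E₀ + m k ≤ E(k)` when every gap is `≥ m`. [folklore] -/
theorem add_mul_le_Erad {gap : ℕ → ℕ} (gap' : ℕ → ℕ) (E₀ : ℕ) {m : ℕ} (hgap : ∀ n, m ≤ gap n) (k : ℕ) :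
    E₀ + m * k ≤ Erad gap gap' E₀ k := by
  induction k with
  | zero => simp
  | succ k ih =>
    have h1 : Erad gap gap' E₀ k + gap (Erad gap gap' E₀ k) ≤ Erad gap gap' E₀ (k + 1) :=
      (Erad_add_gap_le_Frad_succ gap gap' E₀ k).trans (Frad_le_Erad gap gap' E₀ _)
    have h2 := hgap (Erad gap gap' E₀ k)
    nlinarith

end BoxProdZ2

/-! ## §1 The corridor residue at run histories from per-probe schedules -/

namespace Skelφ

open Literature.Probability.Percolation Literature.Probability.LatticeModels SimpleGraph GadgetSystem ProbeHistory HSiteScheme Contour KNCells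
open KNCells.KSchA KNLevels ChainPlanar
open Literature.Probability.Percolation.GM
open Literature.Probability.Percolation.KozmaNitzan.Cells (sgOf stepVec_apply_fst stepVec_apply_oth)
open Literature.Barriers.CriticalPhenomena (graphBall graphBall_finite mem_graphBall_self graphBall_mono)
open BoxProdZ2 (ConcRadiiG nQ nS Erad Frad Erad_mono Frad_succ Frad_le_Erad Erad_add_gap_le_Frad_succ add_mul_le_Erad)
open Skel (excess winGraphIn winGraphIn_le nmaxC ReachOblAtH ReachOblRH l1_tgt_le_nQ)

open scoped Classical

variable {V : Type} [DecidableEq V] {G : SimpleGraph V} [G.LocallyFinite] {φ : V → Site 2}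

/-- **RESIDUE (C) AT RUN HISTORIES, two-unit scheme of record, from per-probe planar schedules** (habitat form, rim-covering kit premise).
For the scheme `S = ⟨cellGeomSG G φ P t (concRadii2S P gap gap' E₀ L'), q, δc⟩` rooted at `t` (`φ t = 0`), schedules `SchOf y du` of the probes
with the three planar rooms, length `≤ nmaxC` and radius `R' ≥ Rlev + 1`, the radii rooms (`20·rmax ≤ gap`, `L' ≤ gap`, `44·rmax + 3 ≤ E₀`), a
uniform excess radius `Rex` (`hRex`, `hsch`), the count, and the per-step kit clauses at run histories for every window-chain record
`Pd : WinChainData V` with the run's field values whose rim parts cover the far vertices of the regions: `Skel.ReachOblRH G S FD Δ' δ`.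
[cite: KozmaNitzan2024, §4 Lemma 12 (pp. 23–25), p. 30 (Step IV), p. 31] -/
theorem reachOblRH_of_schedules [Countable V] (hlip : Lip G φ) (hstep : Steps G φ) (P : PCells2) (t : V) (gap gap' : ℕ → ℕ)
    (E₀ L' : ℕ) (q : unitInterval) (δc : ℝ) {R' Rlev N j₀ j₁ : ℕ} (hRl : Rlev + 1 ≤ R') (hj : j₁ ≤ Rlev)
    (hΛ : WFS2 P (concRadii2S P gap gap' E₀ L')) (hφ : φ t = 0) (hgap : ∀ n, 20 * P.rmax ≤ gap n) (hE₀ : 44 * P.rmax + 3 ≤ E₀)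
    (hgapL : ∀ ρ, L' ≤ gap ρ)
    -- the planar schedules of the probes: start at `M_y`, regions in `Q_y ∪ H_{y,du}`, end in `M_{y+du} ∩ H_{y,du}`, length, radius
    (SchOf : Site 2 → MDir → Schedule) (hM0 : ∀ y du, P.M y ⊆ (SchOf y du).core 0)
    (hreg : ∀ y du, ∀ k ≤ (SchOf y du).N, (SchOf y du).region k ⊆ P.Q y ∪ P.Hfull y du)
    (hlast : ∀ y du, (SchOf y du).core ((SchOf y du).N + 1) ⊆ P.M (y + stepVec du) ∩ P.Hfull y du)
    (hn : ∀ y du, (SchOf y du).N ≤ nmaxC) (hR' : ∀ y du, (SchOf y du).R' = R')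
    {Δ' : ℕ} {δ η : ℝ} (hcount : 1 / (1 - (q : ℝ)) ^ (Δ' * N) ≤ δ * ((Finset.Icc j₀ j₁).card : ℝ)) (hη : η ≤ δ / 2)
    {Rex : ℕ → ℕ}
    (hRex : ∀ R₀' R₁, Rex R₀' ≤ R₁ → ∀ (Rw : ℕ) (D' A' : Finset V), (∀ d ∈ D', d ∈ graphBall G t Rw) →
      (∀ d ∈ D', ∀ d' ∈ D', φ d - φ d' ∈ box 2 (50 * P.rmax)) → A' ⊆ D' → (∀ a ∈ A', a ∈ graphBall G t R₀') →
        (bondPercolation G q).real (excess G t R₁ D' A') ≤ η)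
    (hsch : ∀ g, Rex (Erad gap gap' E₀ g + 1) + L' ≤ Erad gap gap' E₀ (g + 1)) :
    let S : KSchA V ℕ := ⟨cellGeomSG G φ P t (concRadii2S P gap gap' E₀ L'), q, δc⟩
    (∀ (ω : BondConfig V) (n : ℕ) (e : Site 2 × MDir),
      (S.astOf₂ G (S.hst₂ G ω n)).st.choice = some e → S.Valid₂ G (S.hst₂ G ω n) e → ∀ du ∈ S.onward G (S.hst₂ G ω n) (tgt e),
      ∀ Pd : WinChainData V,
      Pd.o = t → Pd.Sfin = S.Sx G (S.hst₂ G ω n) e (S.aOf₁ G (S.hst₂ G ω n) e) (S.aOf₂ G (S.hst₂ G ω n) e) du →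
      Pd.Rlev = Rlev → Pd.N = N → Pd.j₀ = j₀ → Pd.j₁ = j₁ →
      (∀ k, ∀ v ∈ (planarWindowIn hlip (habΩ G φ P t (Λ := concRadii2S P gap gap' E₀ L') q δc (S.hst₂ G ω n) e (S.aOf₂ G (S.hst₂ G ω n) e)
          du)).stepD (SchOf (tgt e) du) k,
        v ∉ graphBall G t (Erad gap gap' E₀ (nQ (S.aOf₁ G (S.hst₂ G ω n) e) (tgt e)) - L') → v ∈ Pd.Rim k) →
      ∀ k ≤ (SchOf (tgt e) du).N, ∀ j ∈ Finset.Icc Pd.j₀ Pd.j₁,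
      ∃ (σ : KNLevels.SData V) (Sz : Finset V),
      KNLevels.SHyp (Pd.stepL (planarWindowIn hlip (habΩ G φ P t (Λ := concRadii2S P gap gap' E₀ L') q δc (S.hst₂ G ω n) e
          (S.aOf₂ G (S.hst₂ G ω n) e) du)) (SchOf (tgt e) du) k) j σ ∧ σ.N ≤ Pd.N ∧
      (1 - (q : ℝ) ^ σ.sB) ^ σ.k ≤ δ ∧
      Sz ⊆ (Pd.stepL (planarWindowIn hlip (habΩ G φ P t (Λ := concRadii2S P gap gap' E₀ L') q δc (S.hst₂ G ω n) e
          (S.aOf₂ G (S.hst₂ G ω n) e) du)) (SchOf (tgt e) du) k).X j ∧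
      Sz ⊆ (planarWindowIn hlip (habΩ G φ P t (Λ := concRadii2S P gap gap' E₀ L') q δc (S.hst₂ G ω n) e (S.aOf₂ G (S.hst₂ G ω n) e)
          du)).stepD (SchOf (tgt e) du) k ∧
      (∀ x ∈ σ.K, ∀ e' ∈ σ.seed x, e' ∉ wireSet (↑Sz : Set V)) ∧ (∀ x ∈ σ.K, σ.face x ⊆ Sz) ∧
      (∀ x ∈ σ.K, 1 - 3 * δ ≤ (prodBernoulli (S.Wcor G (faceDataSG G φ P t (concRadii2S P gap gap' E₀ L')) (S.hst₂ G ω n) e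
          (S.aOf₁ G (S.hst₂ G ω n) e) (S.aOf₂ G (S.hst₂ G ω n) e) du)).real {ω' | ∃ u ∈ σ.face x,
        1 - δ < (prodBernoulli (pinW (S.Wcor G (faceDataSG G φ P t (concRadii2S P gap gap' E₀ L')) (S.hst₂ G ω n) e
          (S.aOf₁ G (S.hst₂ G ω n) e) (S.aOf₂ G (S.hst₂ G ω n) e) du) (wireSet (↑Sz : Set V)) ω')).real
          (⋃ t' ∈ Pd.coreE (planarWindowIn hlip (habΩ G φ P t (Λ := concRadii2S P gap gap' E₀ L') q δc (S.hst₂ G ω n) e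
              (S.aOf₂ G (S.hst₂ G ω n) e) du)) (SchOf (tgt e) du) k,
            openConnIn (↑((planarWindowIn hlip (habΩ G φ P t (Λ := concRadii2S P gap gap' E₀ L') q δc (S.hst₂ G ω n) e
              (S.aOf₂ G (S.hst₂ G ω n) e) du)).stepD (SchOf (tgt e) du) k) : Set V) u t')})) →
    ReachOblRH G S (faceDataSG G φ P t (concRadii2S P gap gap' E₀ L')) Δ' δ := by
  intro S hkitsR h e hrun hc hV du hdu
  obtain ⟨ω, n, rfl⟩ := hrun
  have hE₀1 : 1 ≤ E₀ := by omega
  -- the radii at the realised triple (`α = aOf₁`, `β = aOf₂`, `E = E(nQ α y)`)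
  obtain ⟨hEQ, hBE, hρ, -, hM, hgen⟩ := reach_radii_concSG (P := P) (t := t) (gap := gap) (gap' := gap') (E₀ := E₀) (L' := L')
    (q := q) (δc := δc) hgap hE₀1 hφ hc hV hdu
  -- abbreviations (after the radii, so that the arithmetic sees one atom per radius)
  set Λ := concRadii2S P gap gap' E₀ L' with hΛdef
  set α := S.aOf₁ G (S.hst₂ G ω n) e with hαdef
  set β := S.aOf₂ G (S.hst₂ G ω n) e with hβdef
  set y := tgt e with hydef
  have hB : Λ.rB α e.1 e.2 ≤ Erad gap gap' E₀ (nQ α y) := le_of_eq hBE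
  have hρle : ∀ ℓ, Λ.ρ β y du ℓ ≤ Erad gap gap' E₀ (nQ α y) := fun ℓ => by rw [hρ ℓ]; exact Nat.sub_le _ _
  -- the onward direction is not the way back (the source column is explored)
  have hdur : du ≠ rev e.2 := by
    rintro rfl
    obtain ⟨y', hy', hyc⟩ := hV.src_mem
    have h1 := (Finset.mem_filter.1 hdu).2 y' hy'
    rw [show tgt e + stepVec (rev e.2) = e.1 from tgt_tgt_rev e] at h1
    exact h1 hyc
  -- the column room: `20 rmax ‖y‖₁ + 44 rmax + 1 ≤ E - 2`
  have hl1 : (y 0).natAbs + (y 1).natAbs ≤ nQ α y :=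
    l1_tgt_le_nQ (cellGeomSG_anchor G φ P t Λ q δc) (cellGeomSG_a₀ G φ P t Λ q δc) _ hc
  have hdrift : E₀ + 20 * P.rmax * nQ α y ≤ Erad gap gap' E₀ (nQ α y) := add_mul_le_Erad gap' E₀ hgap _
  have hmul : 20 * P.rmax * ((y 0).natAbs + (y 1).natAbs) ≤ 20 * P.rmax * nQ α y := Nat.mul_le_mul_left _ hl1
  have hcolQ : 20 * P.rmax * ((y 0).natAbs + (y 1).natAbs) + 44 * P.rmax + 1 ≤ Λ.rQ α y := by
    rw [hEQ]; omega
  have hcolρ : ∀ ℓ, 20 * P.rmax * ((y 0).natAbs + (y 1).natAbs) + 44 * P.rmax + 1 ≤ Λ.ρ β y du ℓ := fun ℓ => by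
    rw [hρ ℓ]; omega
  have hρM : ∀ ℓ, Λ.ρ β y du ℓ + 1 ≤ Λ.rM β (y + stepVec du) := fun ℓ => by
    rw [hρ ℓ, hM, Frad_succ]
    have := hgapL (Erad gap gap' E₀ (nQ α y))
    omega
  -- the excess radius fits below the rim depth
  have hRexE : Rex (Erad gap gap' E₀ (nS α e.1) + 1) ≤ Erad gap gap' E₀ (nQ α y) - L' := by
    refine Nat.le_sub_of_add_le ?_
    rw [hgen]
    exact hsch _
  -- the choice at the run's macro-state, deep entrances along the run
  have hc' : ((S.scheme₂ G).stN n ω).choice = some e := by rw [S.stN_eq₂]; exact hc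
  have hdeep := deep_of_run hlip hstep P t gap gap' E₀ L' q δc hΛ hφ hgap hE₀1 ω n hc' hdu β
  -- the window-chain record: fresh habitat, schedule of the probe, rims = far vertices of the regions
  set Ω := habΩ G φ P t (Λ := Λ) q δc (S.hst₂ G ω n) e β du with hΩdef
  set 𝒲 := planarWindowIn hlip Ω with h𝒲def
  set Sch := SchOf y du with hSchdef
  let Pd : WinChainData V :=
    { Rlev := Rlev, N := N, j₀ := j₀, j₁ := j₁, o := t, Sfin := S.Sx G (S.hst₂ G ω n) e α β du,
      Rim := fun k => (𝒲.stepD Sch k).filter fun v => v ∉ graphBall G t (Erad gap gap' E₀ (nQ α y) - L') }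
  have hRimD : ∀ k, Pd.Rim k ⊆ 𝒲.stepD Sch k := fun k => Finset.filter_subset _ _
  have hRimfar : ∀ k, ∀ v ∈ Pd.Rim k, v ∉ graphBall G t (Erad gap gap' E₀ (nQ α y) - L') := fun k v hv => (Finset.mem_filter.1 hv).2
  -- the regions lie in the fresh habitat and in the habitat proper `Q_α(y) ∪ E^far_β`
  have hSt := stepsGeomSG P t hΛ hstep (Λ := Λ)
  have hDΩ : ∀ k, 𝒲.stepD Sch k ⊆ Ω := fun k v hv => ((mem_WinIn (φ := φ)).1 hv).1
  have hDh : ∀ k ≤ Sch.N, 𝒲.stepD Sch k ⊆ S.Γ.Q α y ∪ S.Γ.Efar β y du := by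
    intro k hk v hv
    obtain ⟨hvΩ, hvφ⟩ := (mem_WinIn (φ := φ)).1 hv
    rcases mem_Q_or_Hfull_of_mem_habΩ hdur hvΩ (hreg y du k hk hvφ) with hvQ | hvH
    · exact Finset.mem_union_left _ hvQ
    · exact hSt.Hfull_subset _ _ _ _ hV.anch hvH
  -- the rim excess
  have hexc : ∀ k ≤ Sch.N, (prodBernoulli (S.Wcor G (faceDataSG G φ P t Λ) (S.hst₂ G ω n) e α β du)).real
      (⋃ t' ∈ Pd.Rim k, openConn t t') ≤ η := by
    intro k hk
    exact real_rim_le_concSG hlip hstep hΛ hV hV.anch hdu hEQ hB hρle hdeep (hRex _) hRexE ((hRimD k).trans (hDΩ k))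
      ((hRimD k).trans (hDh k hk)) (hRimfar k)
  -- the kit clauses at this run
  have hkits := hkitsR ω n e hc hV du hdu Pd rfl rfl rfl rfl rfl rfl (fun k v hv hfar => Finset.mem_filter.2 ⟨hv, hfar⟩)
  exact reachOblAtH_of_schedule hlip hstep hΛ hφ hV hV.anch hdu hdur Sch (hM0 y du) (hreg y du) (hlast y du) (hn y du) Pd rfl rfl hRimD
    (by rw [hR' y du]; exact hRl) hj hcolQ hcolρ hρM hcount hkits hη hexc

end Skelφ

end Transplant

end Summit.CriticalPhenomena.PercolationContinuityZ3.Theorems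

end
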